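import Literature.Analysis.FluidPDE.NSVorticity
import Literature.Analysis.FluidPDE.ClassicalSobolevUniqueness
import HarnessLib

/-!
# Constantin 1986: as long as the Euler solution is smooth, the slightly viscous Navier–Stokes
# solutions from the same datum are smooth and `O(ν)`-close — what transfers to `ν > 0`

Topic `Literature/Analysis/FluidPDE`. Statements file: ONE named fact with its cite tag, stated in the
tree's vocabulary (`IsClassicalEulerSolutionOn` / `IsClassicalNSSolutionOn` of `ClassicalSolution.lean`,
the Beale–Kato–Majda class `HasBoundedSobolevNormsOn` of `NSVorticity.lean`, and the `ℝ≥0∞`-valued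
`L²` seminorms `∫⁻ ‖Dⁿw‖ₑ²` in which that class is written), plus kernel-proved consequences. Source:
`[Constantin1986]` P. Constantin, *Note on loss of regularity for solutions of the 3-D incompressible
Euler and related equations*, Comm. Math. Phys. **104** (1986) 311–326, §1 "A comparison result",
**Theorem 1.1** (held text: `lit read doi:10.1007/bf01211598`, the technical-report version of the same
paper, p. 9–13 of 29: statement p. 9–10, energy inequality (1.9)–(1.13) p. 10, ODE Lemma 1.3 p. 11).

## The printed statement

**Theorem 1.1.** Let `v = v(t,x)` be a solution of the incompressible Euler equations with force `f`
on `ℝ³` (or `𝕋³`) for `0 < t ≤ T`, with initial datum `v₀` satisfying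
(1.2) `‖v₀‖_{H^{m+2}} < ∞` for some `m ≥ 3`, and
(1.3) `∫₀ᵀ ‖∇ × v(t)‖_{L^∞} dt < ∞`.
Then there exists `ν₀ = ν₀(T, ‖v₀‖_{m+2}, f, ∫₀ᵀ‖∇ × v‖_{L^∞} dt) > 0` such that, for every
`0 < ν ≤ ν₀`, the solution `u` of the Navier–Stokes equations (1.4)
`∂ₜu + (u·∇)u − νΔu + ∇q = f`, `div u = 0`, `u(0) = v₀` is smooth on `[0, T]`. More precisely
(1.5) `sup_{t ∈ [0,T]} ‖u(t) − v(t)‖_{H^m} ≤ C ν` for a constant depending on `T`, `‖v₀‖_{m+2}`, `f` and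
`∫₀ᵀ ‖∇ × v‖_{L^∞} dt` ("Let us emphasize here that `∫₀ᵀ‖∇ × v‖_{L^∞}` is not assumed to be small",
p. 9; the linear rate comes from the ODE Lemma 1.3: `y' ≤ νF + Gy²`, `y(0) = 0` has
`y(t) ≤ 2ν∫₀ᵀF` for `ν ≤ ν₀ = (8TG∫₀ᵀF)⁻¹`, p. 11).

Secondary restatements (read): Constantin, Bull. AMS **44** (2007) 603–621 `[Constantin2007]`, §2.1
(held text `paper:doi-10-1090-s0273-0979-07-01184-6` chunk p0006): "It is known that if there are no
singularities in the solution of the Euler equations with initial data `u₀` on the time interval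
`[0, T]`, then there can be no singularities in the Navier–Stokes solution with the same initial data
and small enough viscosity ([36] = [Constantin1986]). The regularity for large enough viscosities is also
known. Unfortunately, there is a gap between the two ranges of viscosities"; §3.1 (p0010): "the
zero-viscosity limit is given by solutions of the Euler equations … the limit holds for as long as the
Euler solution is smooth ([36]). The convergence occurs in the Sobolev space `H^s` as long as the
solution remains in the same space ([108] = [Masmoudi2006])." Masmoudi, Comm. Math. Phys. **270** (2007)
777–788 `[Masmoudi2006]`, Theorem 2.1 + Remark 2.2 (held text `paper:doi-10-1007-s00220-006-0171-5`
p. 3–4): for `s > d/2 + 1`, `u₀ ∈ H^s(ℝ^d)`, `T*` the `H^s` lifespan of the Euler solution `u`, and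
every `T₀ < T*` there is `ν₀ > 0` such that for all `ν ≤ ν₀` the Navier–Stokes system has a unique
solution `u^ν ∈ C([0,T₀]; H^s)` and `‖u^ν − u‖_{L^∞(0,T₀;H^s)} → 0` (`ν → 0`), with the rates
(10) `‖(u^ν − u)(t)‖_{H^{s−2}} ≤ C ν t`, (11) `‖(u^ν − u)(t)‖_{H^{s'}} ≤ C (νt)^{(s−s')/2}`,
`s − 2 ≤ s' ≤ s − 1` — the same two-derivative loss as in (1.5).

## Rendering (special case; `-- TODO(general form)` below)

The tree's classical solutions are `C^∞` in space–time and its Sobolev regularity class is the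
Beale–Kato–Majda class `HasBoundedSobolevNormsOn S u` (`∫ ‖Dⁿu(t)‖² ≤ Cₙ` on `S` for every `n`).
We therefore vendor the case of **unforced** (`f = 0`) flows on `ℝ³` with **`C^∞ ∩ H^∞` data**, in
which the hypotheses (1.2) (every `m`) and (1.3) are implied by asking the classical Euler solution
`(v, q)` to lie in the BKM class on the CLOSED interval `[0, T]` (`‖∇ × v(t)‖_{L^∞} ≤ κ‖v(t)‖_{H³}` is
then bounded on `[0,T]`, tree `exists_enorm_fderiv_le_of_hasBoundedSobolevNormsOn`), and in which
"`u` is smooth on `[0, T]`" reads: a classical Navier–Stokes solution `(u, p)` with `u(0) = v(0)`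
exists on `ℝ³ × [0, T]` and lies in the BKM class on `[0, T]` (with `H^∞` data the solution stays in
every `H^k` as long as it stays in `H³`). The quantitative clause (1.5) is rendered, for the given
`m ≥ 3`, on the `L²` seminorms of the tree's class: `∫ ‖Dⁿ(u(t) − v(t))‖² ≤ (Cν)²` for all `n ≤ m`
and `t ∈ [0,T]` (equivalent to the `H^m`-norm form up to the combinatorial constant `m + 1`). The
threshold `ν₀` and the constant `C` may depend on everything fixed before `ν` (`T`, `v`, `m`), as
printed. Uniqueness is not part of the fact: it is the tree's theorem
`IsClassicalNSSolutionOn.eq_of_hasBoundedSobolevNormsOn` (Majda–Bertozzi Cor. 3.1, PROVED in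
`ClassicalSobolevUniqueness.lean`), used below.

## Proved consequences ("what transfers to `ν > 0`", by name)

* `Constantin1986.viscousPersistence.rate_of_solution`: for `ν ≤ ν₀` the rate (1.5) holds for ANY
  classical Navier–Stokes solution on `[0,T]` from `v(0)` in the BKM class (uniqueness).
* `Constantin1986.viscousPersistence.hasSmoothExtensionPast`, `.not_isMaximalSmoothSolution`: for
  `ν ≤ ν₀(T)` no classical Navier–Stokes solution from `v(0)` in the BKM class has a lifespan
  `T₁ < T` — the viscous lifespan at small viscosity is at least the Euler regularity horizon.
* `Constantin1986.viscousPersistence.euler_breakdown_of_viscous_breakdown`: the contrapositive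
  TRANSFER — if, along viscosities accumulating at `0`, NO classical Navier–Stokes solution from the
  datum `u₀` lives on `[0, T]` in the BKM class, then no classical Euler solution from `u₀` lives on
  `[0, T]` in the BKM class ("a viscous breakdown before `T` that survives `ν ↓ 0` forces an Euler
  breakdown by `T`"; cf. [Constantin2007] §2.1 and the cell's reading rule R10 «a fixed-time `ν`-law
  surviving `ν → 0` for a fixed smooth datum ⇔ Euler loses smoothness by then», whose decl this is).
* `Constantin1986.viscousPersistence.seminorm_sub_le_of_small` : the inviscid limit in `H^m` read off
  (1.5) — for every `ε > 0` there is `ν₁ > 0` such that for `ν ∈ (0, ν₁]` the viscous solution satisfies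
  `∫ ‖Dⁿ(u^ν(t) − v(t))‖² ≤ ε` for all `t ∈ [0,T]`, `n ≤ m`;
* `Constantin1986.viscousPersistence.euler_breakdown_of_viscous_breakdown_seq`: the transfer along a
  sequence `νₖ → 0⁺`.

## What this is NOT — scope (say so when citing)

Whole space (or torus), NO boundary, SMOOTH (`H^{m+2}`, `m ≥ 3`) data. The theorem is SILENT on
(a) the `C^{1,α}` blow-up families (Elgindi, Elgindi–Ghoul–Masmoudi, Córdoba–Martínez-Zoroa–Zheng,
Chen 2026, Shkoller 2026: tree `elgindi_euler_blowup`, `CordobaMartinezZoroaZheng2023.holderEulerBlowup`,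
`Chen2026.asymptSelfSimilarBlowup`, …), whose data are not in `H^{7/2+}` — no printed inviscid-limit
theorem covers them up to the blow-up time; and (b) smooth-data Euler blow-up in domains WITH
boundary (Chen–Hou), where the vanishing-viscosity limit under no-slip conditions is open
([Constantin2007] §3.1; [Masmoudi2006] §1). It asserts neither Navier–Stokes regularity nor blow-up:
it converts Euler regularity on `[0,T]` into Navier–Stokes regularity on `[0,T]` for `ν ≤ ν₀(T)` only
("there is a gap between the two ranges of viscosities", [Constantin2007] §2.1).
-/

noncomputable section

open MeasureTheory Set Function Filter
open _root_.Topology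
open scoped NNReal ENNReal ContDiff

namespace Literature.Analysis.FluidPDE

namespace Constantin1986

/-! ### The named fact -/

/-- **Constantin 1986, Theorem 1.1** (Comm. Math. Phys. 104 (1986) 311–326, §1 "A comparison result";
held report text p. 9–10: "Let `v = v(t,x)` be a solution of (1.1) for `0 < t ≤ T` … (1.2)
`‖v₀‖_{m+2} < ∞` for some `m ≥ 3`, (1.3) `∫₀ᵀ‖∇ × v‖_{L^∞} dt < ∞`. Then there exists
`ν₀ = ν₀(T, ‖v₀‖_{m+2}, f, ∫₀ᵀ‖∇ × v‖_{L^∞})` such that, for every `0 < ν ≤ ν₀` the solution to the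
Navier–Stokes equation (1.4) … `u(0,·) = v₀` is smooth on `[0,T]`. More precisely (1.5)
`sup_{t∈[0,T]} ‖u(t) − v(t)‖_m ≤ Cν`"), **special case** `f = 0`, `C^∞ ∩ H^∞` data on `ℝ³`
(module docstring, § Rendering): for `T > 0` and a classical Euler solution `(v, q)` on `ℝ³ × [0,T]`
in the Beale–Kato–Majda class on `[0,T]`, and for every `m ≥ 3`, there are `ν₀ > 0` and `C` such that
for every `ν ∈ (0, ν₀]` a classical Navier–Stokes solution `(u, p)` with viscosity `ν`, no force and
datum `u(0) = v(0)` exists on `ℝ³ × [0,T]`, lies in the BKM class on `[0,T]`, and satisfies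
`∫ ‖Dⁿ(u(t) − v(t))‖² ≤ (Cν)²` for all `t ∈ [0,T]`, `n ≤ m`. [cite: Constantin1986, §1 Theorem 1.1 with (1.2), (1.3), (1.5) (CMP 104 p. 311–326; report text p. 9–11, Lemma 1.3)] -/
def viscousPersistence : Prop :=
  ∀ (T : ℝ) (_ : 0 < T)
    (v : ℝ → EuclideanSpace ℝ (Fin 3) → EuclideanSpace ℝ (Fin 3))
    (q : ℝ → EuclideanSpace ℝ (Fin 3) → ℝ)
    (_ : IsClassicalEulerSolutionOn (Icc 0 T) 0 v q)
    (_ : HasBoundedSobolevNormsOn (Icc 0 T) v)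
    (m : ℕ) (_ : 3 ≤ m),
    ∃ ν₀ : ℝ, 0 < ν₀ ∧ ∃ C : ℝ≥0, ∀ ν ∈ Ioc 0 ν₀,
      ∃ (u : ℝ → EuclideanSpace ℝ (Fin 3) → EuclideanSpace ℝ (Fin 3))
        (p : ℝ → EuclideanSpace ℝ (Fin 3) → ℝ),
        IsClassicalNSSolutionOn (Icc 0 T) ν 0 u p ∧ u 0 = v 0 ∧
          HasBoundedSobolevNormsOn (Icc 0 T) u ∧
          ∀ t ∈ Icc 0 T, ∀ n ≤ m,
            ∫⁻ x, ‖iteratedFDeriv ℝ n (u t - v t) x‖ₑ ^ 2 ≤ ((C : ℝ≥0∞) * ENNReal.ofReal ν) ^ 2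

-- TODO(general form): forced flows `f ≠ 0` (same statement, `ν₀` and `C` depending on `f`), data of
-- finite smoothness `v₀ ∈ H^{m+2}` with `v` a solution on `(0,T]` under (1.3) only, and the periodic
-- case `𝕋³`; Masmoudi's `H^s` form (every `T₀ < T*`, convergent data `u₀ⁿ → u₀`, no derivative loss in
-- the qualitative convergence) needs an `H^s`-solution class the tree does not have on `ℝ³`.

/-! ### Proved consequences -/

namespace viscousPersistence

variable {T : ℝ} {v : ℝ → EuclideanSpace ℝ (Fin 3) → EuclideanSpace ℝ (Fin 3)}
  {q : ℝ → EuclideanSpace ℝ (Fin 3) → ℝ} {m : ℕ}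

/-- The existence clause alone ("`u` is smooth on `[0,T]`"): for `ν ≤ ν₀` a classical Navier–Stokes
solution from `v(0)` in the BKM class exists on `[0,T]` (with `m = 3`). [cite: Constantin1986, §1 Theorem 1.1] -/
theorem exists_classicalNS (h : viscousPersistence) (hT : 0 < T)
    (hv : IsClassicalEulerSolutionOn (Icc 0 T) 0 v q) (hB : HasBoundedSobolevNormsOn (Icc 0 T) v) :
    ∃ ν₀ : ℝ, 0 < ν₀ ∧ ∀ ν ∈ Ioc 0 ν₀,
      ∃ (u : ℝ → EuclideanSpace ℝ (Fin 3) → EuclideanSpace ℝ (Fin 3))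
        (p : ℝ → EuclideanSpace ℝ (Fin 3) → ℝ),
        IsClassicalNSSolutionOn (Icc 0 T) ν 0 u p ∧ u 0 = v 0 ∧
          HasBoundedSobolevNormsOn (Icc 0 T) u := by
  obtain ⟨ν₀, hν₀, _C, hall⟩ := h T hT v q hv hB 3 le_rfl
  refine ⟨ν₀, hν₀, fun ν hν => ?_⟩
  obtain ⟨u, p, hu, hu0, hBu, -⟩ := hall ν hν
  exact ⟨u, p, hu, hu0, hBu⟩

/-- **The rate holds for THE solution.** For `ν ≤ ν₀` the bound (1.5) holds for every classical
Navier–Stokes solution `(w, r)` on `[0,T]` from `v(0)` in the BKM class — by uniqueness in that class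
(tree `IsClassicalNSSolutionOn.eq_of_hasBoundedSobolevNormsOn`, Majda–Bertozzi Cor. 3.1, proved). [cite: Constantin1986, §1 Theorem 1.1, (1.5)] -/
theorem rate_of_solution (h : viscousPersistence) (hT : 0 < T)
    (hv : IsClassicalEulerSolutionOn (Icc 0 T) 0 v q) (hB : HasBoundedSobolevNormsOn (Icc 0 T) v)
    (hm : 3 ≤ m) :
    ∃ ν₀ : ℝ, 0 < ν₀ ∧ ∃ C : ℝ≥0, ∀ ν ∈ Ioc 0 ν₀,
      ∀ (w : ℝ → EuclideanSpace ℝ (Fin 3) → EuclideanSpace ℝ (Fin 3))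
        (r : ℝ → EuclideanSpace ℝ (Fin 3) → ℝ),
        IsClassicalNSSolutionOn (Icc 0 T) ν 0 w r → w 0 = v 0 →
          HasBoundedSobolevNormsOn (Icc 0 T) w →
          ∀ t ∈ Icc 0 T, ∀ n ≤ m,
            ∫⁻ x, ‖iteratedFDeriv ℝ n (w t - v t) x‖ₑ ^ 2 ≤ ((C : ℝ≥0∞) * ENNReal.ofReal ν) ^ 2 := by
  obtain ⟨ν₀, hν₀, C, hall⟩ := h T hT v q hv hB m hm
  refine ⟨ν₀, hν₀, C, fun ν hν w r hw hw0 hBw t ht n hn => ?_⟩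
  obtain ⟨u, p, hu, hu0, hBu, hrate⟩ := hall ν hν
  have hwu : w t = u t :=
    hw.eq_of_hasBoundedSobolevNormsOn hu hν.1.le hT hBw hBu (hw0.trans hu0.symm) ht
  rw [hwu]
  exact hrate t ht n hn

/-- **No viscous breakdown before the Euler horizon.** For `ν ≤ ν₀(T)`: a classical Navier–Stokes
solution `(w, r)` from `v(0)` on some `[0, T₁)`, `0 < T₁ < T`, lying in the BKM class on every
`[0, T''] ⊆ [0, T₁)`, extends as a classical solution past `T₁` (tree `HasSmoothExtensionPast`):
the solution of the fact, restricted to `[0, T)`, is such an extension, because it agrees with `w` on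
every closed `[0, T'']`, `T'' < T₁`, by uniqueness in the class. [cite: Constantin1986, §1 Theorem 1.1] -/
theorem hasSmoothExtensionPast (h : viscousPersistence) (hT : 0 < T)
    (hv : IsClassicalEulerSolutionOn (Icc 0 T) 0 v q) (hB : HasBoundedSobolevNormsOn (Icc 0 T) v) :
    ∃ ν₀ : ℝ, 0 < ν₀ ∧ ∀ ν ∈ Ioc 0 ν₀, ∀ {T₁ : ℝ}, 0 < T₁ → T₁ < T →
      ∀ (w : ℝ → EuclideanSpace ℝ (Fin 3) → EuclideanSpace ℝ (Fin 3))
        (r : ℝ → EuclideanSpace ℝ (Fin 3) → ℝ),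
        IsClassicalNSSolutionOn (Ico 0 T₁) ν 0 w r → w 0 = v 0 →
          (∀ T'' < T₁, HasBoundedSobolevNormsOn (Icc 0 T'') w) →
          HasSmoothExtensionPast ν 0 w T₁ := by
  obtain ⟨ν₀, hν₀, hall⟩ := exists_classicalNS h hT hv hB
  refine ⟨ν₀, hν₀, fun ν hν T₁ hT₁ hT₁T w r hw hw0 hBw => ?_⟩
  obtain ⟨u, p, hu, hu0, hBu⟩ := hall ν hν
  refine ⟨T, hT₁T, u, p, hu.mono Ico_subset_Icc_self (uniqueDiffOn_Ico 0 T), fun t ht => ?_⟩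
  -- agree on `[0, T'']` with `T'' = (t + T₁)/2`
  set T'' : ℝ := (t + T₁) / 2 with hT''
  have htT'' : t < T'' := by rw [hT'']; linarith [ht.2]
  have hT''T₁ : T'' < T₁ := by rw [hT'']; linarith [ht.2]
  have hT''pos : 0 < T'' := lt_of_le_of_lt ht.1 htT''
  have hsub₁ : Icc 0 T'' ⊆ Ico 0 T₁ := fun s hs => ⟨hs.1, lt_of_le_of_lt hs.2 hT''T₁⟩
  have hsub₂ : Icc 0 T'' ⊆ Icc 0 T := fun s hs => ⟨hs.1, hs.2.trans (hT''T₁.trans hT₁T).le⟩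
  have hw' : IsClassicalNSSolutionOn (Icc 0 T'') ν 0 w r :=
    hw.mono hsub₁ (uniqueDiffOn_Icc hT''pos)
  have hu' : IsClassicalNSSolutionOn (Icc 0 T'') ν 0 u p :=
    hu.mono hsub₂ (uniqueDiffOn_Icc hT''pos)
  exact (hu'.eq_of_hasBoundedSobolevNormsOn hw' hν.1.le hT''pos (hBu.mono hsub₂) (hBw T'' hT''T₁)
    (hu0.trans hw0.symm) ⟨ht.1, htT''.le⟩)

/-- Reformulation: for `ν ≤ ν₀(T)` no classical Navier–Stokes solution from `v(0)` that lies in the BKM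
class on compact subintervals is MAXIMAL with a lifespan `T₁ < T` (tree `IsMaximalSmoothSolution`). [cite: Constantin1986, §1 Theorem 1.1] -/
theorem not_isMaximalSmoothSolution (h : viscousPersistence) (hT : 0 < T)
    (hv : IsClassicalEulerSolutionOn (Icc 0 T) 0 v q) (hB : HasBoundedSobolevNormsOn (Icc 0 T) v) :
    ∃ ν₀ : ℝ, 0 < ν₀ ∧ ∀ ν ∈ Ioc 0 ν₀, ∀ {T₁ : ℝ}, 0 < T₁ → T₁ < T →
      ∀ (w : ℝ → EuclideanSpace ℝ (Fin 3) → EuclideanSpace ℝ (Fin 3))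
        (r : ℝ → EuclideanSpace ℝ (Fin 3) → ℝ),
        w 0 = v 0 → (∀ T'' < T₁, HasBoundedSobolevNormsOn (Icc 0 T'') w) →
          ¬ IsMaximalSmoothSolution ν 0 w r T₁ := by
  obtain ⟨ν₀, hν₀, hall⟩ := hasSmoothExtensionPast h hT hv hB
  refine ⟨ν₀, hν₀, fun ν hν T₁ hT₁ hT₁T w r hw0 hBw hmax => ?_⟩
  exact hmax.2 (hall ν hν hT₁ hT₁T w r hmax.1 hw0 hBw)

/-- **The contrapositive transfer** ([Constantin2007] §2.1; the decl behind the cell's reading rule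
R10). Fix `T > 0` and a datum `u₀`. If along viscosities accumulating at `0` — for every `ν₀ > 0` some
`ν ∈ (0, ν₀]` — there is NO classical Navier–Stokes solution from `u₀` on `ℝ³ × [0,T]` in the BKM class
("the viscous flow breaks down before `T`, and this survives `ν ↓ 0`"), then there is no classical
Euler solution from `u₀` on `ℝ³ × [0,T]` in the BKM class ("the Euler flow loses smoothness by `T`"). [cite: Constantin1986, §1 Theorem 1.1 (contrapositive)] -/
theorem euler_breakdown_of_viscous_breakdown (h : viscousPersistence) (hT : 0 < T)
    {u₀ : EuclideanSpace ℝ (Fin 3) → EuclideanSpace ℝ (Fin 3)}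
    (hNS : ∀ ν₀ : ℝ, 0 < ν₀ → ∃ ν ∈ Ioc 0 ν₀,
      ¬ ∃ (u : ℝ → EuclideanSpace ℝ (Fin 3) → EuclideanSpace ℝ (Fin 3))
          (p : ℝ → EuclideanSpace ℝ (Fin 3) → ℝ),
          IsClassicalNSSolutionOn (Icc 0 T) ν 0 u p ∧ u 0 = u₀ ∧ HasBoundedSobolevNormsOn (Icc 0 T) u) :
    ¬ ∃ (v : ℝ → EuclideanSpace ℝ (Fin 3) → EuclideanSpace ℝ (Fin 3))
        (q : ℝ → EuclideanSpace ℝ (Fin 3) → ℝ),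
        IsClassicalEulerSolutionOn (Icc 0 T) 0 v q ∧ v 0 = u₀ ∧ HasBoundedSobolevNormsOn (Icc 0 T) v := by
  rintro ⟨v, q, hv, hv0, hB⟩
  obtain ⟨ν₀, hν₀, hall⟩ := exists_classicalNS h hT hv hB
  obtain ⟨ν, hν, hno⟩ := hNS ν₀ hν₀
  obtain ⟨u, p, hu, hu0, hBu⟩ := hall ν hν
  exact hno ⟨u, p, hu, hu0.trans hv0, hBu⟩

/-- The same transfer along a SEQUENCE of viscosities `νₖ → 0⁺`: if for every `k` no classical
Navier–Stokes solution with viscosity `νₖ` from `u₀` lives on `[0,T]` in the BKM class, the Euler flow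
from `u₀` is not smooth (BKM class) on `[0,T]`. [cite: Constantin1986, §1 Theorem 1.1 (contrapositive)] -/
theorem euler_breakdown_of_viscous_breakdown_seq (h : viscousPersistence) (hT : 0 < T)
    {u₀ : EuclideanSpace ℝ (Fin 3) → EuclideanSpace ℝ (Fin 3)} {νs : ℕ → ℝ}
    (hpos : ∀ k, 0 < νs k) (hlim : Tendsto νs atTop (𝓝 0))
    (hNS : ∀ k, ¬ ∃ (u : ℝ → EuclideanSpace ℝ (Fin 3) → EuclideanSpace ℝ (Fin 3))
          (p : ℝ → EuclideanSpace ℝ (Fin 3) → ℝ),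
          IsClassicalNSSolutionOn (Icc 0 T) (νs k) 0 u p ∧ u 0 = u₀ ∧
            HasBoundedSobolevNormsOn (Icc 0 T) u) :
    ¬ ∃ (v : ℝ → EuclideanSpace ℝ (Fin 3) → EuclideanSpace ℝ (Fin 3))
        (q : ℝ → EuclideanSpace ℝ (Fin 3) → ℝ),
        IsClassicalEulerSolutionOn (Icc 0 T) 0 v q ∧ v 0 = u₀ ∧ HasBoundedSobolevNormsOn (Icc 0 T) v := by
  refine euler_breakdown_of_viscous_breakdown h hT fun ν₀ hν₀ => ?_
  obtain ⟨k, hk⟩ := ((tendsto_order.1 hlim).2 ν₀ hν₀).exists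
  exact ⟨νs k, ⟨hpos k, hk.le⟩, hNS k⟩

/-- **The inviscid limit in `H^m` on `[0,T]`** ((1.5) read as `ν → 0⁺`): along the solutions given by
the fact, `∫ ‖Dⁿ(u^ν(t) − v(t))‖² ≤ (Cν)² → 0`; packaged as: for every `ε > 0` there is `ν₁ > 0` such
that for all `ν ∈ (0, ν₁]` a classical Navier–Stokes solution from `v(0)` exists on `[0,T]` (BKM class)
with `∫ ‖Dⁿ(u(t) − v(t))‖² ≤ ε` for all `t ∈ [0,T]`, `n ≤ m`. [cite: Constantin1986, §1 Theorem 1.1, (1.5)] -/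
theorem seminorm_sub_le_of_small (h : viscousPersistence) (hT : 0 < T)
    (hv : IsClassicalEulerSolutionOn (Icc 0 T) 0 v q) (hB : HasBoundedSobolevNormsOn (Icc 0 T) v)
    (hm : 3 ≤ m) {ε : ℝ≥0∞} (hε : 0 < ε) :
    ∃ ν₁ : ℝ, 0 < ν₁ ∧ ∀ ν ∈ Ioc 0 ν₁,
      ∃ (u : ℝ → EuclideanSpace ℝ (Fin 3) → EuclideanSpace ℝ (Fin 3))
        (p : ℝ → EuclideanSpace ℝ (Fin 3) → ℝ),
        IsClassicalNSSolutionOn (Icc 0 T) ν 0 u p ∧ u 0 = v 0 ∧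
          HasBoundedSobolevNormsOn (Icc 0 T) u ∧
          ∀ t ∈ Icc 0 T, ∀ n ≤ m, ∫⁻ x, ‖iteratedFDeriv ℝ n (u t - v t) x‖ₑ ^ 2 ≤ ε := by
  obtain ⟨ν₀, hν₀, C, hall⟩ := h T hT v q hv hB m hm
  -- choose `ν₁ ≤ ν₀` with `(C ν₁)² ≤ ε`
  have h1 : Tendsto (fun ν : ℝ => (C : ℝ≥0∞) * ENNReal.ofReal ν) (𝓝 0) (𝓝 0) := by
    have h := ENNReal.Tendsto.const_mul (a := (C : ℝ≥0∞))
      (ENNReal.tendsto_ofReal (tendsto_id (x := 𝓝 (0 : ℝ)))) (Or.inr ENNReal.coe_ne_top)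
    simpa using h
  have hcont : Tendsto (fun ν : ℝ => ((C : ℝ≥0∞) * ENNReal.ofReal ν) ^ 2) (𝓝[>] 0) (𝓝 0) := by
    have h := (ENNReal.Tendsto.pow (n := 2) h1).mono_left (nhdsWithin_le_nhds (s := Ioi (0 : ℝ)))
    simpa using h
  have hev : ∀ᶠ ν in 𝓝[>] (0 : ℝ), ((C : ℝ≥0∞) * ENNReal.ofReal ν) ^ 2 ≤ ε ∧ ν ∈ Ioc 0 ν₀ := by
    refine ((tendsto_order.1 hcont).2 ε hε).mono (fun ν hν => hν.le) |>.and ?_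
    exact Ioc_mem_nhdsGT hν₀
  obtain ⟨ν₁, hν₁mem, hν₁⟩ := (hev.and self_mem_nhdsWithin).exists
  refine ⟨ν₁, hν₁, fun ν hν => ?_⟩
  have hνν₀ : ν ∈ Ioc 0 ν₀ := ⟨hν.1, hν.2.trans hν₁mem.2.2⟩
  obtain ⟨u, p, hu, hu0, hBu, hrate⟩ := hall ν hνν₀
  refine ⟨u, p, hu, hu0, hBu, fun t ht n hn => (hrate t ht n hn).trans ?_⟩
  calc ((C : ℝ≥0∞) * ENNReal.ofReal ν) ^ 2 ≤ ((C : ℝ≥0∞) * ENNReal.ofReal ν₁) ^ 2 := by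
        gcongr; exact hν.2
    _ ≤ ε := hν₁mem.1

end viscousPersistence

end Constantin1986

end Literature.Analysis.FluidPDE

end
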